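import Literature.AnabelianGeometry.SemiGraphs.TemperedCoverings
import Literature.AnabelianGeometry.SemiGraphs.TreeSystemFixedPointQuotient

/-!
# [SemiAnbd] Theorem 3.7 (iii), first part: the assembly modulo the level data of the chart

Mochizuki, *Semi-graphs of Anabelioids*, Publ. RIMS **42** (2006) 221–322, §3 pp. 40–41
[cite: MochizukiSemiAnbd2006, Thm. 3.7(iii) p.41]: "every compact subgroup `H ⊆ π₁^temp(𝒢)` is
contained in at least one verticial subgroup".  The printed proof runs: `π₁^temp(𝒢) = lim Gal`
over a cofinal system of finite Galois coverings `𝒢_i → 𝒢`; the image of `H` at each level is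
finite and acts, over `𝒢`, on the tree `𝒢_{∞,i}` (universal graph-covering of `𝒢_i`), hence fixes
a vertex (Lemma 1.8 (ii)(a)); pushing down to the FINITE `𝒢_i` and passing to a cofinal subsystem
gives "a compatible system of vertices `ṽ = {v_i}` of the `𝒢_i` fixed by `H`; in particular
`H ⊆ π₁^temp(𝒢)_ṽ`", and `π₁^temp(𝒢)_ṽ` (the decomposition group of the pro-vertex) is a
verticial subgroup.

This proof-only file is the ASSEMBLY of that argument for an arbitrary chart
`c : TemperedPiChart 𝒢` (`TemperedCoverings.lean`), modulo the LEVEL DATA of the chart — stated as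
explicit hypotheses, to be supplied by the construction of Proposition 3.6 (i)(ii) (rung 1,
abc-iut-L3-t9): a directed family of trees `T_j` over `𝔾` with vertices (the `𝒢_{∞,j}`, trees by
`SemiGraph.univCover_isTree`), actions `ρ_j : π₁^temp(𝒢) → Aut T_j` over `𝔾` with open kernels,
finite sets `V_j` (vertices of the `𝒢_j`) with actions `σ_j`, equivariant projections
`q_j : Vert T_j → V_j` and transition maps `π`, and the IDENTIFICATION `hident`: the pointwise
stabiliser of a compatible system of level vertices lies in a verticial subgroup.  Everything
else is `TreeSystemFixedPointQuotient.exists_compatible_fixed_points_of_quotients`.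

* `ProfiniteSemiGraph.compactInVerticial_conj1_of_levelData` — the first conjunct of
  `CompactInVerticial` for the chart `c`, from the level data.
-/

namespace Literature.AnabelianGeometry.SemiGraphs

namespace ProfiniteSemiGraph

open CategoryTheory Topology

universe u v w'

variable {𝒢 : ProfiniteSemiGraph.{u}}

/-- **Theorem 3.7 (iii), first part, modulo the level data of the chart** (p. 41): if the
tempered fundamental group `c.G` of the chart `c` acts, over the underlying semi-graph and through
homomorphisms with open kernels, on a directed system of trees `T_j` covering finite levels `V_j`
(equivariantly, with equivariant transition maps), and the pointwise stabiliser of every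
compatible system of level vertices lies in a verticial subgroup, then every compact subgroup of
`c.G` lies in a verticial subgroup. [cite: MochizukiSemiAnbd2006, Thm. 3.7(iii) p.41] -/
theorem compactInVerticial_conj1_of_levelData (c : TemperedPiChart 𝒢)
    {J : Type v} [Preorder J] [IsDirectedOrder J] (T : J → SemiGraph.{u})
    (hT : ∀ j, (T j).IsTree) (v₀ : ∀ j, (T j).Vertex) (p : ∀ j, T j ⟶ 𝒢.graph)
    (ρ : ∀ j, c.G →* Aut (T j)) (hker : ∀ j, IsOpen ((ρ j).ker : Set c.G))
    (hover : ∀ (j : J) (g : c.G), (ρ j g).hom ≫ p j = p j)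
    (V : J → Type w') [∀ j, Finite (V j)] (σ : ∀ j, c.G → V j → V j)
    (q : ∀ j, (T j).Vertex → V j)
    (hq : ∀ (j : J) (g : c.G) (x : (T j).Vertex), q j ((ρ j g).hom.vertexMap x) = σ j g (q j x))
    (π : ∀ ⦃i j : J⦄, i ≤ j → V j → V i)
    (π_id : ∀ (j : J) (x : V j), π le_rfl x = x)
    (π_comp : ∀ ⦃i j k : J⦄ (hij : i ≤ j) (hjk : j ≤ k) (x : V k),
      π hij (π hjk x) = π (hij.trans hjk) x)
    (hequiv : ∀ ⦃i j : J⦄ (h : i ≤ j) (g : c.G) (x : V j), π h (σ j g x) = σ i g (π h x))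
    (hident : ∀ x : (∀ j, V j), (∀ ⦃i j : J⦄ (h : i ≤ j), π h (x j) = x i) →
      ∃ (v : 𝒢.graph.Vertex) (H : Subgroup c.G), H ∈ verticialSubgroups c v ∧
        ∀ g : c.G, (∀ j, σ j g (x j) = x j) → g ∈ H)
    (C : Subgroup c.G) (hC : IsCompact (C : Set c.G)) :
    ∃ (v : 𝒢.graph.Vertex) (H : Subgroup c.G), H ∈ verticialSubgroups c v ∧ C ≤ H := by
  -- a compatible system of `C`-fixed vertices of the finite levels
  obtain ⟨x, hx, hcompat⟩ := SemiGraph.exists_compatible_fixed_points_of_quotients C hC 𝒢.graph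
    T hT v₀ p ρ hker hover V σ q hq π π_id π_comp hequiv
  -- its pointwise stabiliser lies in a verticial subgroup, and contains `C`
  obtain ⟨v, H, hH, hstab⟩ := hident x hcompat
  exact ⟨v, H, hH, fun g hg => hstab g fun j => hx j ⟨g, hg⟩⟩

end ProfiniteSemiGraph

end Literature.AnabelianGeometry.SemiGraphs
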